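import Summits.HodgeConjecture.HodgeConjecture.Theorems.PadicSemiregularLiftHodgeBeyondAnchorsDiagonalPullback
import Literature.AlgebraicTopology.CharacteristicClasses.ProjectiveBundleTrivialisedLerayHirsch
import Literature.AlgebraicGeometry.HodgeTheory.ZariskiProjectiveBundleComplexPoints
import Literature.AlgebraicGeometry.Motives.FlatSubfamilyProofs
import Literature.AlgebraicGeometry.HodgeTheory.AlgebraicClassesPullback
import Literature.AlgebraicGeometry.HodgeTheory.AlgebraicCyclesDefinedOverQbar
import Literature.AlgebraicGeometry.HodgeTheory.ComplexGysinSurjective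
import Literature.AlgebraicGeometry.HodgeTheory.WeilClassesFourfoldsProofs
import Literature.AlgebraicTopology.CharacteristicClasses.ProjectiveSpaceLerayHirsch
import Literature.AlgebraicTopology.SingularHomology.CohomologyVanishingNearUnion
import Literature.AlgebraicTopology.SingularHomology.LerayHirschGlobal
import HarnessLib

/-!
# Leray–Hirsch for a Zariski-locally trivial `ℙʳ`-bundle of smooth projective varieties

Route `BoundaryReadout` / `QbarEnvelope` of `HodgeConjecture`, crux `PullbackAlgebraic`
(stmt-HodgeConjecture-1071), line `normal_cone`, stub `stub_bundleLerayHirsch` (the topological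
heart of the section pull-back). Let `q : E ⟶ X` be a `ℂ`-morphism of smooth projective complex
varieties (`dim X = n`, `dim E = n + r`) which is, Zariski-locally over `X`, isomorphic over `X` to
the projection `U ⊗ ℙʳ_ℂ → U`. Then there is a class `ζ ∈ N¹ H²(E(ℂ); ℂ)` with

* (i) `q_*(ζʳ) = c • 1_X`, `c ≠ 0`, for the Gysin morphism `q_* : H²ʳ(E(ℂ)) → H⁰(X(ℂ))` of any
  orientation family;
* (ii) every `y ∈ H²ᵖ(E(ℂ); ℂ)` is `Σ_{b ≤ min r p} ζᵇ ∪ q^* x_b` with `x_b ∈ H²ᵖ⁻²ᵇ(X(ℂ); ℂ)`.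

Proof (D. Husemoller, *Fibre Bundles*, Ch. 17 §1 Thm. 1.1 and §2 Thm. 2.5; A. Hatcher, *Algebraic
Topology*, Thm. 4D.1; C. Voisin, *Hodge Theory I*, Lemma 7.32). `ζ` is the pull-back of a generator
`h` of `H²(ℙᴺ(ℂ); ℂ)` along a projective embedding `E ↪ ℙᴺ`; it is algebraic because every class of
`ℙᴺ` is (`algebraicClasses_projectiveSpace_eq_top`) and pull-back preserves `N¹ H²`
(`map_mem_algebraicClasses_one`, Lefschetz `(1,1)`). On complex points `q(ℂ)` is, over the open
`U(ℂ)` of each trivialising `U`, homeomorphic over `U(ℂ)` to `U(ℂ) × ℙ(ℂ^{r+1}) → U(ℂ)`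
(`ZariskiProjectiveBundle.exists_trivialisation`), and `ζ` restricts non-trivially to every fibre (the
fibre is a closed positive-dimensional smooth subvariety `ℙʳ ↪ E ↪ ℙᴺ`,
`ZariskiProjectiveBundle.map_two_ne_zero_of_isClosedImmersion`, Voisin I §3.3.2). Over a CONTRACTIBLE open `P ⊆ U(ℂ)` (small chart balls, which cover) the
transported class is therefore `c • pr₂^* x` with `c ≠ 0` (`x` the tautological class of
`ℙ(ℂ^{r+1})`; the degree-`2` case of the product Leray–Hirsch theorem), so its powers are a rescaled
Leray–Hirsch basis over every open `W ⊆ P` (`isLH_of_trivialisation`, from the tree's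
`projectiveSpace_lerayHirsch`), and the tree's local-to-global theorem
`LerayHirsch.bijective_of_cover` makes `(a_j)_{j ≤ r} ↦ Σ q^* a_j ∪ ζʲ` bijective onto `H*(E(ℂ))`;
(ii) is its surjectivity (graded commutativity in even degrees to write `ζᵇ ∪ q^* x_b`). For (i):
`q_*(ζʳ) ∈ H⁰(X(ℂ)) = ℂ · 1` (`X(ℂ)` path connected); if the scalar vanished, the projection
formula `q_*(q^* a ∪ ζʳ) = a ∪ q_*(ζʳ)` and the top-degree case of (ii) (`H^{>2n}(X(ℂ)) = 0`) would
force `q_* = 0 : H^{2n+2r}(E(ℂ)) → H^{2n}(X(ℂ)) ≠ 0`, whereas `q_*` is onto there: `q^*` is one-to-one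
on `H⁰` by Leray–Hirsch, so `q(ℂ)_*` is onto on `H₀` (universal coefficients) and `q_*` is `q(ℂ)_*`
read through Poincaré duality (`capProduct_complexGysin`).

## References

* [HusemollerFibreBundles1994] D. Husemoller, Fibre Bundles, 3rd ed., GTM 20, Springer 1994,
  Ch. 17 §1 Thm. 1.1, §2 Thm. 2.5.
* [HatcherAT2002] A. Hatcher, Algebraic Topology, CUP 2002, §3.2 Thm. 3.16, §3.3 Thm. 3.30,
  §4.D Thm. 4D.1.
* [VoisinHodgeI2002] C. Voisin, Hodge Theory and Complex Algebraic Geometry I, CUP 2002, §3.3.2,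
  §7.3.2 Lemma 7.28, §7.3.3 Lemma 7.32.
* [FultonYoungTableaux1997] W. Fulton, Young Tableaux, CUP 1997, App. B §B.1 (5)–(6).
* [Fulton1998] W. Fulton, Intersection Theory, 2nd ed., Springer 1998, Thm. 3.3 (b).
-/

noncomputable section

-- `Summit.HodgeConjecture.HodgeConjecture.…` is the mandated namespace (single-conjunct summit).
set_option linter.dupNamespace false

namespace Summit.HodgeConjecture.HodgeConjecture.Theorems.PullbackAlgebraicNormalCone

open CategoryTheory AlgebraicGeometry MonoidalCategory CartesianMonoidalCategory
  Literature.AlgebraicGeometry Literature.AlgebraicGeometry.Motives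
  Literature.AlgebraicGeometry.HodgeTheory
open Literature.AlgebraicTopology.SingularHomology (cupProduct)

namespace BundleLerayHirsch

open Function Set Literature.AlgebraicTopology.SingularHomology
  Literature.AlgebraicTopology.SingularHomology.LerayHirsch
  Literature.AlgebraicTopology.CharacteristicClasses Literature.NumberTheory.Transcendental
open scoped LinearAlgebra.Projectivization Topology

section Main

variable {n r : ℕ} {X E : SchemeOver ℂ} (q : E ⟶ X) (hX : IsSmoothProjective n X)
  (hE : IsSmoothProjective (n + r) E)
  (htriv : ∀ x : X.left, ∃ U : X.left.Opens, x ∈ U ∧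
    ∃ φ : (Over.mk ((q.left ⁻¹ᵁ U).ι ≫ E.hom) : SchemeOver ℂ) ≅
        (Over.mk (U.ι ≫ X.hom) : SchemeOver ℂ) ⊗ Motives.projectiveSpace r ℂ,
      φ.hom.left ≫ (fst (Over.mk (U.ι ≫ X.hom) : SchemeOver ℂ)
        (Motives.projectiveSpace r ℂ)).left ≫ U.ι = (q.left ⁻¹ᵁ U).ι ≫ q.left)
  (ζ : complexBetti E 2)
  (hζ : 1 ≤ r → ∀ ι : Motives.projectiveSpace r ℂ ⟶ E, IsClosedImmersion ι.left → complexBetti.map ι 2 ζ ≠ 0)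

/-- `LH(ℂ^{r+1}, r + 1)`: the product Leray–Hirsch theorem for `ℙ(ℂ^{r+1})` (the tree's
`projectiveSpace_lerayHirsch`). [cite: HusemollerFibreBundles1994, Ch. 17 §2 Thm. 2.5] -/
theorem isProjLH_fin (r : ℕ) : IsProjLH ℂ (Fin (r + 1) → ℂ) (r + 1) :=
  projectiveSpace_lerayHirsch ℂ r (Fin (r + 1) → ℂ) (Module.finrank_fin_fun ℂ)

include hX htriv hζ in
/-- **The hereditary local Leray–Hirsch input around every point of `X(ℂ)`**: every `b ∈ X(ℂ)` has
an open neighbourhood `P` (a contractible chart ball inside `U(ℂ)`, `U ∋ b` trivialising) such that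
the comparison map of `q(ℂ)⁻¹W → W` with the classes `ζʲ|`, `j ≤ r`, is bijective for every `W ⊆ P`:
over `P` the bundle is `P × ℙ(ℂ^{r+1})` and `ζ|` is `c • pr₂^* x` with `c ≠ 0` (fibre restriction
non-zero). [cite: HusemollerFibreBundles1994, Ch. 17 §1 Thm. 1.1 and §2 Thm. 2.5 (proof)]
[cite: VoisinHodgeI2002, §7.3.3 Lemma 7.32] -/
theorem exists_isOpen_isLH (b : ComplexPoints X) :
    ∃ P : Set (ComplexPoints X), IsOpen P ∧ b ∈ P ∧ ∀ W ⊆ P,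
      IsLH ℂ (evenDeg (r + 1)) (AlgPoints.mapContinuous (L := ℂ) q) (fun j ↦ cupPow ℂ ζ j) W := by
  letI := hX.chartedSpace
  haveI := hX.smoothOfRelativeDimension
  haveI : LocallyOfFiniteType X.hom := by
    haveI : Smooth X.hom := SmoothOfRelativeDimension.smooth n _
    infer_instance
  obtain ⟨U, hbU, φ, hφ⟩ := htriv b.pt
  have hUBo : IsOpen {P : ComplexPoints X | P.pt ∈ U} := AlgPoints.isOpen_setOf_pt_mem U
  obtain ⟨P, hPo, hbP, hPU, hPc⟩ :=
    exists_isOpen_contractibleSpace_subset (d := 2 * n) b {P : ComplexPoints X | P.pt ∈ U} (hUBo.mem_nhds hbU)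
  haveI := hPc
  -- the trivialisation over `U(ℂ)`, restricted over `P`
  set pm : C(ComplexPoints E, ComplexPoints X) := AlgPoints.mapContinuous (L := ℂ) q with hpm
  set V : Type := Fin (r + 1) → ℂ with hV
  have hLH : IsProjLH ℂ V (r + 1) := isProjLH_fin r
  obtain ⟨T, hT, η, hfib⟩ := ZariskiProjectiveBundle.exists_trivialisation φ hφ
  obtain ⟨TP, hTP, hTPsymm⟩ := exists_trivRestrict pm hPU T hT
  -- the scalar `c` and the transported classes
  obtain ⟨c, hc, hcls⟩ : ∃ c : ℂ, c ≠ 0 ∧ ∀ j : Fin (r + 1),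
      singularCohomology.map ℂ ℂ (TP.symm : C(↥P × ℙ ℂ V, ↥(pm ⁻¹' P))) (evenDeg (r + 1) j)
        (resCls pm P (fun j ↦ cupPow ℂ ζ j) j) = c ^ (j : ℕ) • projCls ℂ V ↥P (r + 1) j := by
    rcases Nat.eq_zero_or_pos r with hr | hr
    · -- `r = 0`: only the class `ζ⁰ = 1`
      subst hr
      refine ⟨1, one_ne_zero, fun j ↦ ?_⟩
      obtain ⟨j, hj⟩ := j
      obtain rfl : j = 0 := by omega
      rw [one_pow, one_smul]
      have e1 : ∀ {A A' : Type} [TopologicalSpace A] [TopologicalSpace A'] (f : C(A, A')),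
          singularCohomology.map ℂ ℂ f (2 * 0) (singularCohomology.one ℂ A') = singularCohomology.one ℂ A :=
        fun f ↦ singularCohomology.map_one f
      change singularCohomology.map ℂ ℂ (TP.symm : C(↥P × ℙ ℂ V, ↥(pm ⁻¹' P))) (2 * 0)
        (singularCohomology.map ℂ ℂ (subsetIncl (pm ⁻¹' P)) (2 * 0) (cupPow ℂ ζ 0)) =
        singularCohomology.map ℂ ℂ (ContinuousMap.snd : C(↥P × ℙ ℂ V, ℙ ℂ V)) (2 * 0) (cupPow ℂ (tautEuler V ℂ 1) 0)
      rw [cupPow_zero, cupPow_zero, e1, e1, e1]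
    · -- `r ≥ 1`: `ζ|` is `c • pr₂^* x` over the contractible `P`, `c ≠ 0` by the fibre restriction
      have hP2 : Subsingleton (singularCohomology ℂ ℂ ↥P 2) :=
        ModuleCat.subsingleton_of_isZero (singularCohomology.isZero_of_contractibleSpace ℂ ↥P two_ne_zero)
      set y : singularCohomology ℂ ℂ (↥P × ℙ ℂ V) 2 :=
        singularCohomology.map ℂ ℂ (TP.symm : C(↥P × ℙ ℂ V, ↥(pm ⁻¹' P))) 2
          (singularCohomology.map ℂ ℂ (subsetIncl (pm ⁻¹' P)) 2 ζ) with hydef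
      have hP0 : ∀ z : singularCohomology ℂ ℂ ↥P 0, ∃ c : ℂ, z = c • singularCohomology.one ℂ ↥P :=
        fun z ↦ ⟨_, Literature.AlgebraicGeometry.HodgeTheory.eq_smul_one_of_pathConnectedSpace z⟩
      obtain ⟨c, hy⟩ := exists_eq_smul_map_snd_tautEuler V hLH hr ↥P hP0 hP2 y
      have hc : c ≠ 0 := by
        intro h0
        -- the slice `v ↦ (b, v)` of `P × ℙ(V)` is a closed fibre embedding `ℙʳ ⟶ E` on complex points
        obtain ⟨ιb, hιb, hιv⟩ := hfib ⟨b, hPU hbP⟩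
        let sl : C(ℙ ℂ V, ↥P × ℙ ℂ V) := ⟨fun v ↦ (⟨b, hbP⟩, v), continuous_const.prodMk continuous_id⟩
        have h1 : singularCohomology.map ℂ ℂ sl 2 y = 0 := by
          rw [hy, h0, zero_smul, map_zero]
        have hcomp : (subsetIncl (pm ⁻¹' P)).comp ((TP.symm : C(↥P × ℙ ℂ V, ↥(pm ⁻¹' P))).comp sl) =
            (AlgPoints.mapContinuous (L := ℂ) ιb).comp (η : C(ℙ ℂ V, ComplexPoints (Motives.projectiveSpace r ℂ))) := by
          ext1 v
          change ((TP.symm (⟨b, hbP⟩, v) : ↥(pm ⁻¹' P)) : ComplexPoints E) = AlgPoints.map ιb (η v)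
          rw [hTPsymm]
          exact hιv v
        have h2 : singularCohomology.map ℂ ℂ sl 2 y =
            singularCohomology.map ℂ ℂ (η : C(ℙ ℂ V, ComplexPoints (Motives.projectiveSpace r ℂ))) 2
              (complexBetti.map ιb 2 ζ) := by
          rw [hydef, ← ModuleCat.comp_apply, ← ModuleCat.comp_apply, ← singularCohomology.map_comp,
            ← singularCohomology.map_comp, hcomp, singularCohomology.map_comp, ModuleCat.comp_apply]
        rw [h2] at h1
        exact hζ hr ιb hιb ((LinearEquiv.map_eq_zero_iff
          (singularCohomology.mapIso ℂ ℂ η 2).toLinearEquiv).mp h1)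
      refine ⟨c, hc, fun j ↦ ?_⟩
      change singularCohomology.map ℂ ℂ (TP.symm : C(↥P × ℙ ℂ V, ↥(pm ⁻¹' P))) (2 * (j : ℕ))
        (singularCohomology.map ℂ ℂ (subsetIncl (pm ⁻¹' P)) (2 * (j : ℕ)) (cupPow ℂ ζ j)) =
        c ^ (j : ℕ) • singularCohomology.map ℂ ℂ (ContinuousMap.snd : C(↥P × ℙ ℂ V, ℙ ℂ V)) (2 * (j : ℕ))
          (cupPow ℂ (tautEuler V ℂ 1) j)
      rw [map_cupPow, map_cupPow, map_cupPow, ← cupPow_smul, ← hy]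
  exact ⟨P, hPo, hbP, fun W hWP ↦ isLH_of_trivialisation pm V hLH (fun j ↦ cupPow ℂ ζ j) TP hTP hc hcls hWP⟩

include hX htriv hζ in
/-- **The Leray–Hirsch theorem for `q(ℂ)`**: `(a_j)_{j ≤ r} ↦ Σⱼ q^* a_j ∪ ζʲ` is a bijection
`Π_{2j ≤ k} Hᵏ⁻²ʲ(X(ℂ); ℂ) → Hᵏ(E(ℂ); ℂ)` for every `k` (the tree's local-to-global
`LerayHirsch.bijective_of_cover` over the compact Hausdorff `X(ℂ)`, fed with `exists_isOpen_isLH`).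
[cite: HusemollerFibreBundles1994, Ch. 17 §1 Thm. 1.1, §2 Thm. 2.5] [cite: HatcherAT2002, §4.D Thm. 4D.1] -/
theorem bijective_lhMap (k : ℕ) :
    Bijective (lhMap ℂ (evenDeg (r + 1)) (AlgPoints.mapContinuous (L := ℂ) q) (fun j ↦ cupPow ℂ ζ j) k) := by
  haveI := ComplexPoints.t2Space_of_isSmoothProjective hX
  haveI := ComplexPoints.compactSpace_of_isSmoothProjective hX
  choose P hPo hbP hLH using exists_isOpen_isLH q hX htriv ζ hζ
  exact bijective_of_cover ℂ (evenDeg (r + 1)) _ _ P hPo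
    (eq_univ_of_forall fun b ↦ mem_iUnion.2 ⟨b, hbP b⟩) (fun b W _ hWP ↦ hLH b W hWP) k

include hX htriv hζ in
/-- **(ii) The Leray–Hirsch expansion** `y = Σ_{b ≤ min r p} ζᵇ ∪ q^* x_b` of every
`y ∈ H²ᵖ(E(ℂ); ℂ)` (surjectivity of `bijective_lhMap` in degree `2p`; the summands with `j > p` are
absent, and `q^* a ∪ ζᵇ = ζᵇ ∪ q^* a` in even degrees). [cite: VoisinHodgeI2002, §7.3.3 Lemma 7.32]
[cite: HatcherAT2002, §4.D Thm. 4D.1 and Thm. 3.11] -/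
theorem exists_expansion (p : ℕ) (y : complexBetti E (2 * p)) :
    ∃ x : (b : Fin (min r p + 1)) → complexBetti X (2 * (p - (b : ℕ))),
      y = ∑ b : Fin (min r p + 1),
        cupProduct (show 2 * (b : ℕ) + 2 * (p - (b : ℕ)) = 2 * p by omega) (cupPow ℂ ζ b)
          (complexBetti.map q (2 * (p - (b : ℕ))) (x b)) := by
  obtain ⟨a, ha⟩ := (bijective_lhMap q hX htriv ζ hζ (2 * p)).2 y
  have hmin : min r p + 1 ≤ r + 1 := by omega
  let ι : Fin (min r p + 1) ↪ Fin (r + 1) := Fin.castLEEmb hmin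
  have hιle : ∀ b : Fin (min r p + 1), evenDeg (r + 1) (ι b) ≤ 2 * p := fun b ↦ by
    change 2 * (b : ℕ) ≤ 2 * p
    omega
  have e : ∀ b : Fin (min r p + 1), 2 * p - evenDeg (r + 1) (ι b) = 2 * (p - (b : ℕ)) := fun b ↦ by
    change 2 * p - 2 * (b : ℕ) = 2 * (p - (b : ℕ))
    omega
  have h' : ∀ b : Fin (min r p + 1), 2 * (b : ℕ) + (2 * p - evenDeg (r + 1) (ι b)) = 2 * p := fun b ↦ by
    change 2 * (b : ℕ) + (2 * p - 2 * (b : ℕ)) = 2 * p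
    omega
  refine ⟨fun b ↦ degCast ℂ (e b) (a ⟨ι b, hιle b⟩), ?_⟩
  -- the summands of `θ(a)`
  set G : Fin (r + 1) → complexBetti E (2 * p) := fun j ↦
    if h : evenDeg (r + 1) j ≤ 2 * p then
      cupProduct (Nat.sub_add_cancel h)
        (singularCohomology.map ℂ ℂ (AlgPoints.mapContinuous (L := ℂ) q) (2 * p - evenDeg (r + 1) j) (a ⟨j, h⟩))
        (cupPow ℂ ζ j)
    else 0 with hG
  have hlh : lhMap ℂ (evenDeg (r + 1)) (AlgPoints.mapContinuous (L := ℂ) q) (fun j ↦ cupPow ℂ ζ j) (2 * p) a =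
      ∑ j, G j := lhMap_apply _ _ _ _ _ _
  -- each summand of the statement is `G (ι b)` (graded commutativity in even degrees)
  have hterm : ∀ b : Fin (min r p + 1),
      cupProduct (show 2 * (b : ℕ) + 2 * (p - (b : ℕ)) = 2 * p by omega) (cupPow ℂ ζ b)
        (complexBetti.map q (2 * (p - (b : ℕ))) (degCast ℂ (e b) (a ⟨ι b, hιle b⟩))) = G (ι b) := by
    intro b
    rw [hG]
    dsimp only
    rw [dif_pos (hιle b), map_degCast, cupProduct_degCast_right ℂ (e b) _ (h' b),
      cupProduct_gradedComm_holds ℂ _ (Nat.sub_add_cancel (hιle b)) (h' b),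
      Even.neg_one_pow (Even.mul_left (even_two_mul _) _), one_smul]
    rfl
  rw [← ha, hlh]
  symm
  calc ∑ b : Fin (min r p + 1), cupProduct (show 2 * (b : ℕ) + 2 * (p - (b : ℕ)) = 2 * p by omega)
        (cupPow ℂ ζ b) (complexBetti.map q (2 * (p - (b : ℕ))) (degCast ℂ (e b) (a ⟨ι b, hιle b⟩)))
      = ∑ b : Fin (min r p + 1), G (ι b) := Finset.sum_congr rfl fun b _ ↦ hterm b
    _ = ∑ j ∈ (Finset.univ : Finset (Fin (min r p + 1))).map ι, G j := (Finset.sum_map _ ι G).symm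
    _ = ∑ j, G j := by
      refine Finset.sum_subset (Finset.subset_univ _) fun j _ hj ↦ ?_
      rw [hG]
      dsimp only
      rw [dif_neg]
      intro h
      apply hj
      have hjp : (j : ℕ) ≤ min r p := by
        change 2 * (j : ℕ) ≤ 2 * p at h
        have := j.2
        omega
      exact Finset.mem_map.2 ⟨⟨j, by omega⟩, Finset.mem_univ _, Fin.ext rfl⟩

include hX htriv hζ in
/-- **(i) `q_*(ζʳ) = c • 1_X` with `c ≠ 0`.** `q_*(ζʳ) ∈ H⁰(X(ℂ)) = ℂ · 1` (`X(ℂ)` path connected).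
If `c = 0`: every top-degree class of `E(ℂ)` is `q^* a ∪ ζʳ` (Leray–Hirsch, `H^{>2n}(X(ℂ)) = 0`),
and `q_*(q^* a ∪ ζʳ) = a ∪ q_*(ζʳ) = 0` (projection formula), so `q_* = 0` on `H^{2n+2r}(E(ℂ))`;
but `q_*` is onto `H^{2n}(X(ℂ)) ≠ 0` there (`q^*` one-to-one on `H⁰`, hence `q(ℂ)_*` onto on `H₀`,
and `q_* = D_X⁻¹ q(ℂ)_* D_E`). [cite: FultonYoungTableaux1997, Appendix B §B.1 (5)–(6)]
[cite: VoisinHodgeI2002, §7.3.2 Lemma 7.28 and §7.3.3 Lemma 7.32] [cite: HatcherAT2002, §3.3 Thm. 3.30] -/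
theorem exists_complexGysin_cupPow_eq (μ : OrientationFamily) :
    ∃ c : ℂ, c ≠ 0 ∧
      complexGysin μ hE hX q (show 2 * r + 2 * n = 0 + 2 * (n + r) by omega) (cupPow ℂ ζ r) =
        c • singularCohomology.one ℂ (ComplexPoints X) := by
  have hμ := OrientationFamily.hasPoincareDuality μ
  haveI := pathConnectedSpace_complexPoints_of_isSmoothProjective' hX
  have h0 : 2 * r + 2 * n = 0 + 2 * (n + r) := by omega
  set c : ℂ := singularCohomologyZeroEquiv ℂ ℂ (ComplexPoints X) (complexGysin μ hE hX q h0 (cupPow ℂ ζ r)) with hcdef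
  have hc : complexGysin μ hE hX q h0 (cupPow ℂ ζ r) = c • singularCohomology.one ℂ (ComplexPoints X) :=
    Literature.AlgebraicGeometry.HodgeTheory.eq_smul_one_of_pathConnectedSpace _
  refine ⟨c, fun hc0 ↦ ?_, hc⟩
  rw [hc0, zero_smul] at hc
  -- the top-degree Gysin morphism vanishes
  have hab : 2 * (n + r) + 2 * n = 2 * n + 2 * (n + r) := by omega
  have hzero : ∀ y, complexGysin μ hE hX q hab y = 0 := by
    intro y
    obtain ⟨a, rfl⟩ := (bijective_lhMap q hX htriv ζ hζ (2 * (n + r))).2 y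
    rw [lhMap_succ, map_add]
    have hrest : lhMap ℂ (evenDeg r) (AlgPoints.mapContinuous (L := ℂ) q) (fun i ↦ cupPow ℂ ζ (Fin.castSucc i))
        (2 * (n + r)) (restrictSrc ℂ r (2 * (n + r)) a) = 0 := by
      rw [lhMap_apply]
      refine Finset.sum_eq_zero fun i _ ↦ ?_
      split_ifs with h
      · haveI : Subsingleton (complexBetti X (2 * (n + r) - evenDeg r i)) :=
          subsingleton_complexBetti hX (by change 2 * n < 2 * (n + r) - 2 * (i : ℕ); omega)
        rw [Subsingleton.elim (restrictSrc ℂ r (2 * (n + r)) a ⟨i, h⟩) 0, map_zero, LinearMap.map_zero₂]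
      · rfl
    have htop : 2 * r ≤ 2 * (n + r) := by omega
    rw [hrest, map_zero, zero_add, dif_pos htop]
    have hpq' : 2 * (n + r) - 2 * r + 0 = 2 * n := by omega
    have key := complexGysin_cup hμ hE hX q (Nat.sub_add_cancel htop) hab h0 hpq' (a ⟨Fin.last r, htop⟩) (cupPow ℂ ζ r)
    rw [hc, map_zero] at key
    exact key
  -- but it is onto `H²ⁿ(X(ℂ)) ≠ 0`
  have hinj : Injective (singularCohomology.map ℂ ℂ (AlgPoints.mapContinuous (L := ℂ) q) 0) :=
    injective_map_of_bijective_lhMap _ ζ 0 (bijective_lhMap q hX htriv ζ hζ 0)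
  have hs := surjective_homologyMap_of_injective_cohomologyMap ℂ (AlgPoints.mapContinuous (L := ℂ) q) 0 hinj
  have haE : 2 * (n + r) + 0 = 2 * (n + r) := rfl
  have hbX : 2 * n + 0 = 2 * n := rfl
  have hsurj : Surjective (complexGysin μ hE hX q hab) := by
    intro x
    obtain ⟨h', hh'⟩ := hs (capProduct hbX x (μ hX).fundamentalClass)
    obtain ⟨y, hy⟩ := (hμ hE haE).2 h'
    refine ⟨y, (hμ hX hbX).1 ?_⟩
    rw [poincareDualityMap_apply, poincareDualityMap_apply, capProduct_complexGysin hμ hE hX q hab haE hbX,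
      ← hh', ← hy, poincareDualityMap_apply]
  have h1 := finrank_complexBetti_two_mul_eq_one hX
  haveI : Nontrivial (complexBetti X (2 * n)) := Module.nontrivial_of_finrank_eq_succ h1
  obtain ⟨x, hx⟩ := exists_ne (0 : complexBetti X (2 * n))
  obtain ⟨y, rfl⟩ := hsurj x
  exact hx (hzero y)

end Main

end BundleLerayHirsch

/-- **Stub `stub_bundleLerayHirsch` — Leray–Hirsch for a Zariski-locally trivial `ℙʳ`-bundle of
smooth projective varieties, with a divisor class** (Husemoller Ch. 17 Thm. 1.1 / 2.5, Hatcher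
Thm. 4D.1, Voisin I Lemma 7.32, Fulton 1998 Thm. 3.3 (b)). For `q : E → X` Zariski-locally over `X`
isomorphic to `U ⊗ ℙʳ → U` (`dim X = n`, `dim E = n + r`) there is `ζ ∈ N¹ H²(E(ℂ))` — the pull-back
of a generator of `H²(ℙᴺ(ℂ); ℂ)` along a projective embedding of `E` — with (i) `q_*(ζʳ) = c • 1_X`,
`c ≠ 0`, and (ii) every `y ∈ H²ᵖ(E(ℂ); ℂ)` of the form `Σ_{b ≤ min r p} ζᵇ ∪ q^* x_b`. Proof in the
module docstring (`BundleLerayHirsch.bijective_lhMap`, `.exists_expansion`,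
`.exists_complexGysin_cupPow_eq`). [cite: HusemollerFibreBundles1994, Ch. 17 §1 Thm. 1.1, §2 Thm. 2.5]
[cite: HatcherAT2002, §4.D Thm. 4D.1] [cite: VoisinHodgeI2002, §7.3.3 Lemma 7.32] -/
theorem stub_bundleLerayHirsch :
    ∀ (μ : OrientationFamily) ⦃n r : ℕ⦄ ⦃X E : SchemeOver ℂ⦄ (q : E ⟶ X)
      (hX : IsSmoothProjective n X) (hE : IsSmoothProjective (n + r) E),
      (∀ x : X.left, ∃ U : X.left.Opens, x ∈ U ∧
        ∃ φ : (Over.mk ((q.left ⁻¹ᵁ U).ι ≫ E.hom) : SchemeOver ℂ) ≅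
            (Over.mk (U.ι ≫ X.hom) : SchemeOver ℂ) ⊗ Motives.projectiveSpace r ℂ,
          φ.hom.left ≫ (fst (Over.mk (U.ι ≫ X.hom) : SchemeOver ℂ)
            (Motives.projectiveSpace r ℂ)).left ≫ U.ι = (q.left ⁻¹ᵁ U).ι ≫ q.left) →
      ∃ ζ ∈ algebraicClasses E 1,
        (∃ c : ℂ, c ≠ 0 ∧
          complexGysin μ hE hX q (show 2 * r + 2 * n = 0 + 2 * (n + r) by omega)
              (Literature.AlgebraicTopology.CharacteristicClasses.cupPow ℂ ζ r) =
            c • Literature.AlgebraicTopology.SingularHomology.singularCohomology.one ℂ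
              (Motives.ComplexPoints X)) ∧
        ∀ (p : ℕ) (y : complexBetti E (2 * p)),
          ∃ x : (b : Fin (min r p + 1)) → complexBetti X (2 * (p - (b : ℕ))),
            y = ∑ b : Fin (min r p + 1),
              cupProduct (show 2 * (b : ℕ) + 2 * (p - (b : ℕ)) = 2 * p by omega)
                (Literature.AlgebraicTopology.CharacteristicClasses.cupPow ℂ ζ b)
                (complexBetti.map q (2 * (p - (b : ℕ))) (x b)) := by
  intro μ n r X E q hX hE htriv
  -- a projective embedding of `E` and a class `h ∈ H²(ℙᴺ(ℂ))`, non-zero as soon as `r ≥ 1`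
  obtain ⟨N, emb, hemb⟩ := hE.isProjectiveOver
  haveI := hemb
  have hP : IsSmoothProjective N (Motives.projectiveSpace N ℂ) := isSmoothProjective_projectiveSpace' N
  obtain ⟨h, hh⟩ : ∃ h : complexBetti (Motives.projectiveSpace N ℂ) (2 * 1), 1 ≤ r → h ≠ 0 := by
    by_cases hr : 1 ≤ r
    · have hN : 1 ≤ N := le_trans (show 1 ≤ n + r by omega) (le_of_isClosedImmersion_projectiveSpace hE emb)
      have h1 : Module.finrank ℂ (complexBetti (Motives.projectiveSpace N ℂ) (2 * 1)) = 1 :=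
        finrank_complexBetti_projectiveSpace_two_mul_eq_one N hN
      haveI : Nontrivial (complexBetti (Motives.projectiveSpace N ℂ) (2 * 1)) :=
        Module.nontrivial_of_finrank_eq_succ h1
      obtain ⟨h, hh⟩ := exists_ne (0 : complexBetti (Motives.projectiveSpace N ℂ) (2 * 1))
      exact ⟨h, fun _ ↦ hh⟩
    · exact ⟨0, fun h1 ↦ absurd h1 hr⟩
  -- `ζ = emb^* h` is algebraic (every class of `ℙᴺ` is; pull-back preserves `N¹ H²`)
  refine ⟨complexBetti.map emb (2 * 1) h, HodgeBeyondAnchors.map_mem_algebraicClasses_one hP hE emb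
    (by rw [algebraicClasses_projectiveSpace_eq_top]; exact Submodule.mem_top), ?_⟩
  -- `ζ` restricts non-trivially along every closed immersion `ℙʳ ⟶ E` (`r ≥ 1`)
  have hζ : 1 ≤ r → ∀ ι : Motives.projectiveSpace r ℂ ⟶ E, IsClosedImmersion ι.left →
      complexBetti.map ι 2 (complexBetti.map emb (2 * 1) h) ≠ 0 := fun hr ι hι ↦ by
    haveI := hι
    exact ZariskiProjectiveBundle.map_two_ne_zero_of_isClosedImmersion hr emb (hh hr) ι
  exact ⟨BundleLerayHirsch.exists_complexGysin_cupPow_eq q hX hE htriv _ hζ μ,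
    fun p y ↦ BundleLerayHirsch.exists_expansion q hX htriv _ hζ p y⟩

end Summit.HodgeConjecture.HodgeConjecture.Theorems.PullbackAlgebraicNormalCone

end
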